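import Summits.BirchSwinnertonDyer.BirchSwinnertonDyer.Theorems.KolyvaginRoadThreeCruxIffLeaf
import Summits.BirchSwinnertonDyer.BirchSwinnertonDyer.Theorems.ClassRecordThreeKolyvaginClose
import Summits.BirchSwinnertonDyer.Rank1Residual.X11b.BDPRouteOddPrime
import HarnessLib

/-!
# Route `KolyvaginRoadThree`, deciding crux `ZhangSharpFrameAtThreeHL` (item stmt-BirchSwinnertonDyer-19574): FRAME
# RIGIDITY — one non-zero mod-3 Kolyvagin class at ONE Hoffstein–Luo frame of an A1 curve forces one at EVERY
# Hoffstein–Luo frame; the ∀-frame crux is equivalent to its weakest ∃-frame form (modulo the published inputs)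
# (cell `bsd-stepL`, seat `bsd-stepL-zhang3-p1` g3; `--supports stmt-BirchSwinnertonDyer-19574`, helper)

THEOREMS ONLY (no definition, no named fact, no `sorry`); nothing about Kolyvagin's conjecture at `p = 3` and nothing
about `BSD(E,3)` is asserted; every published input is a named fact of the tree taken as a binder. PARTITION: O2@3
(B10) × A1 (1 116 TRUE-OPEN classes; cw 248 943) — types-the-object-of; closes: none.

THE POINT (seam G-b of the route's design, «certificate frame vs Manin-good frame», TARGET (R-ai)): the deciding crux
is typed in the ∀-FRAME form (a non-zero class at EVERY Manin-good conductor-1 frame of EVERY Hoffstein–Luo field of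
the curve), whereas a computation (BC5 rung) or a memo theorem delivers ONE frame. With the converse of
`KolyvaginRoadThreeCruxIffLeaf.lean` the gap closes in the tree: ONE frame ⟹ `BSD(E,3)` (koly's end-to-end theorem
`ClassX11b.bsdp_three_of_kolyvaginClass_one_ne_zero_of_mccallum`, p410016, here with all its derivable data —
Heegner datum, Heegner point, minimal twist model, conductor-1 datum, the arithmetic of `E(K)` — DISCHARGED from the
first-order binders of a frame) ⟹ EVERY frame (`Koly.kolyvaginClass_one_ne_zero_of_bsdp_of_hlFrame`). Hence, modulo
the published inputs, for an A1 curve the following are equivalent: (a) `BSDp W 3`; (b) some HL frame carries a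
non-zero mod-3 Kolyvagin class `c₁(n)`, `n ∈ Λ₃`; (c) every HL frame does. And the route item
`ZhangSharpFrameAtThreeHL` is equivalent to its weakest ∃-form «every A1 curve has SOME Hoffstein–Luo frame and SOME
level with `c₁(n) ≠ 0`» (Hoffstein–Luo + Mazur supply a frame for the direction ∀ ⟹ ∃: `exists_oddHeegnerData`).

* `Koly.bsdp_three_of_kolyvaginClass_one_ne_zero_at_hlFrame` — END TO END with first-order binders only: A1 curve,
  HL field, admissible Manin-good frame, ONE non-zero class ⟹ `BSDp W 3`;
* `Koly.kolyvaginClass_one_ne_zero_allHLFrames_of_one` — frame rigidity (b) ⟹ (c);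
* `Theorems.zhangSharpFrameAtThreeHL_iff_exists_kolyvaginClass_one_ne_zero` — the route item ⟺ its ∃-frame form.

References (locators only): [cite: WZhang2014, Thm. 1.1, Remark 5 and Thm. 10.2] [cite: McCallumLMS1991, §4 Cor. 4.5,
§5 Lemma 5.1 and Cor. 5.6] [cite: GrossLMS1991, §3 (pp. 238–239), §4 (4.1)] [cite: HoffsteinLuo1997, main theorem]
[cite: Mazur1978, Cor. 4.1] [cite: Darmon2004, Thm. 3.6].
-/

noncomputable section

open scoped Classical

namespace Summit.BirchSwinnertonDyer.Rank1Residual.X11b.Three.Koly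

open WeierstrassCurve NumberField Literature.NumberTheory.EllipticCurves
  Literature.NumberTheory.EllipticCurves.ModularForms
  Literature.NumberTheory.EllipticCurves.Rank1Residual
  Summit.BirchSwinnertonDyer.Rank1Residual Summit.BirchSwinnertonDyer.Rank1Residual.X11b

/-! ## §1 End to end at one HL frame, first-order binders only -/

/-- **KOLYVAGIN ROAD, END TO END, with first-order binders only: ONE non-zero mod-3 Kolyvagin class at ONE
Hoffstein–Luo frame of an A1 curve ⟹ `BSD(E,3)`.**  Data: `W/ℚ` globally minimal with `(E,3) ∈ X11b`, a (ram) witness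
and `3 ∤ ∏_ℓ c_ℓ(E)`; `K` imaginary quadratic, `d_K` odd, Heegner for `N_E`, `L(E^{d_K},1) ≠ 0`; a frame `(Dt, β, ι)`
with `4N ∣ β² − d_K` and `3 ∤ c(Dt)`; a Kolyvagin–Heegner datum `d` of conductor `n ∈ Λ₃` on the frame with
`c₁(n) ≠ 0` (HYPOTHESIS — the content of Kolyvagin's conjecture at this frame). PUBLISHED inputs as binders
(Gross–Zagier, Kolyvagin ×2, Skinner 2016 Thm. C, GZK, modularity, Shimura reciprocity at conductor 1, Gross 1991
§3 ×2, McCallum Cor. 5.6's certificate half). This is koly's `ClassX11b.bsdp_three_of_kolyvaginClass_one_ne_zero_of_mccallum`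
(p410016) with the oriented Heegner datum (`exists_heegnerDatum`), the Heegner point (Darmon Thm. 3.6,
`heegnerPointComplex_mem_range_map_holds`), a minimal model of the twist (`hasGlobalMinimalModel_rat_holds`), the
conductor-1 datum (Gross §3) with `P(1) = y_K` (Shimura reciprocity) and the arithmetic of `E(K)` (non-torsion, rank
one, `Ш` finite, no 3-torsion, `3^{M₀} ∥ y_K`) all DISCHARGED. CONDITIONAL on every binder; nothing is booked.
[cite: WZhang2014, Remark 5 and Thm. 10.2] [cite: McCallumLMS1991, §5 Cor. 5.6] -/
theorem bsdp_three_of_kolyvaginClass_one_ne_zero_at_hlFrame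
    (W : WeierstrassCurve ℚ) [W.IsElliptic] [W.IsGloballyMinimal] [NeZero (W.conductorNorm ℤ)]
    (K : Type) [Field K] [NumberField K]
    (Dt : ModularParametrizationData W (W.conductorNorm ℤ)) (β : ℤ) (ι : K →+* ℂ)
    -- published inputs (named facts of the tree)
    (hGZ : gross_zagier (W.conductorNorm ℤ) W K) (hKo : kolyvagin (W.conductorNorm ℤ) W K)
    (hB : Kolyvagin1990_padicValNat_card_sha_le (W.conductorNorm ℤ) W K)
    (hSk : Skinner2016.thmC_padicValRat_bsd_rank_zero)
    (hGZK : rank_eq_analyticRank_of_analyticRank_le_one) (hmod : hasEntireLFunction_rat)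
    (hrec : heegnerPointOfConductor_one_galoisConj (W.conductorNorm ℤ) W K)
    (h1 : phi_heegnerPointOfConductor_mem_range_map_ringClassField (W.conductorNorm ℤ) W K)
    (h2 : exists_generator_ringClassGalOver K)
    (hMc : McCallum1991_pow_dvd_card_sha_primary_of_certificate)
    -- the pair (A1) and the HL frame
    (hX : ClassX11b W 3) (hram : Ram W 3) (htam : ¬ 3 ∣ W.tamagawaProduct)
    (hK : IsImaginaryQuadratic K) (hodd : Odd (NumberField.discr K))
    (hH : SatisfiesHeegnerHypothesis (W.conductorNorm ℤ) K)
    (hLt : (W.quadraticTwist (NumberField.discr K : ℚ)).entireLFunction 1 ≠ 0)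
    (hβ : (4 * (W.conductorNorm ℤ : ℤ)) ∣ β ^ 2 - NumberField.discr K) (hc : ¬ (3 : ℤ) ∣ Dt.c)
    -- ONE non-zero mod-3 Kolyvagin class on the frame
    {n : ℕ} (d : KolyvaginHeegnerData Dt β ι n)
    (hn : KolyvaginDescent.KolSupp (Zhang2014.IsKolyvaginPrime (W.conductorNorm ℤ) W K 3) n)
    (hne : d.kolyvaginClass Nat.prime_three 1 ≠ 0) :
    BSDp W 3 := by
  haveI : Fact (Nat.Prime 3) := ⟨Nat.prime_three⟩
  have hirr : Irr W 3 := hX.2.2.2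
  have hDneg : NumberField.discr K < 0 := by
    have hND : IsCoprime (W.conductorNorm ℤ : ℤ) (NumberField.discr K) := by
      have h := Literature.SatisfiesHeegnerHypothesis.coprime_discr hK.1 hH
      refine Int.isCoprime_iff_gcd_eq_one.mpr ?_
      rw [Int.gcd_eq_natAbs, Int.natAbs_natCast]
      exact h
    have hlt := discr_lt_neg_four_of_isCoprime_of_dvd_sq_sub hK hND (dvd_conductorNorm_of_classX11b hX) hβ
    omega
  -- the oriented Heegner datum with `H.β = β`, THE Heegner point `P = y_K ∈ E(K)`, a minimal model of the twist
  obtain ⟨H, hHβ⟩ := exists_heegnerDatum (W.conductorNorm ℤ) hDneg hβ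
  obtain ⟨P, hP⟩ := heegnerPointComplex_mem_range_map_holds (W.conductorNorm ℤ) W K hK hH Dt H ι
  have hD0 : (NumberField.discr K : ℚ) ≠ 0 := by exact_mod_cast NumberField.discr_ne_zero K
  haveI hEt : (W.quadraticTwist (NumberField.discr K : ℚ)).IsElliptic := W.isElliptic_quadraticTwist hD0
  obtain ⟨Cd, hCd⟩ := hasGlobalMinimalModel_rat_holds (W.quadraticTwist (NumberField.discr K : ℚ))
  haveI := hCd
  -- arithmetic of `E(K)`
  have hPinf : ¬ IsOfFinAddOrder P :=
    not_isOfFinAddOrder_of_heegner_of_analyticRank_eq_one W (W.conductorNorm ℤ) K Dt H ι P hGZ hmod hX.1 hK hH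
      hLt hP
  obtain ⟨hrank, hSha⟩ := hKo hK hH ⟨Dt, H, ι, hP⟩ hPinf
  haveI : Finite (W.baseChange K).sha := hSha
  have hbot := torsionBy_eq_bot_of_isImaginaryQuadratic_of_hasIrreducibleModPGaloisRep W K hK Nat.prime_three hirr
  have hiv : ∀ x : (W.baseChange K).toAffine.Point, 3 • x = 0 → x = 0 := fun x hx ↦ by
    have hmem : x ∈ AddSubgroup.torsionBy (W.baseChange K).toAffine.Point ((3 : ℕ) : ℤ) := by
      rw [mem_torsionBy_iff, natCast_zsmul]
      exact hx
    rw [hbot] at hmem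
    exact hmem
  haveI : Module.Finite ℤ (W.baseChange K).toAffine.Point := (W.baseChange K).module_finite_point_holds
  obtain ⟨M₀, x₀, hx₀, hmax⟩ := exists_pow_smul_eq_and_forall_ne hPinf (p := 3) (by norm_num)
  have hdiv : ∃ Q : (W.baseChange K).toAffine.Point, ((3 ^ M₀ : ℕ) : ℤ) • Q = P :=
    ⟨x₀, by rw [natCast_zsmul]; exact hx₀⟩
  have hndiv : ¬ ∃ Q : (W.baseChange K).toAffine.Point, ((3 ^ (M₀ + 1) : ℕ) : ℤ) • Q = P := by
    rintro ⟨Q, hQ⟩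
    exact hmax Q (by rw [← natCast_zsmul]; exact hQ)
  -- the conductor-1 datum (Gross §3) and `P(1) = y_K` in `E(K̄)` (Shimura reciprocity)
  obtain ⟨d₁⟩ := Summit.BirchSwinnertonDyer.BirchSwinnertonDyer.Theorems.nonempty_kolyvaginHeegnerData_of_grossCM
    h1 h2 hK hH Dt β ι hβ squarefree_one (by simp)
  have hPd : d₁.toGeomPoints d₁.derivedPoint = toGeomPoints (W.baseChange K) P :=
    KolyvaginBottom.toGeomPoints_derivedPoint_one_eq hrec hK hH hP d₁ hHβ
  exact ClassX11b.bsdp_three_of_kolyvaginClass_one_ne_zero_of_mccallum W K Dt H ι P hGZ hKo hB hSk hGZK hmod hX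
    hram htam hK hodd hH hP hc hLt (Cd • W.quadraticTwist (NumberField.discr K : ℚ)) Cd rfl β d₁ hPd hPinf hrank
    hiv hdiv hndiv d hn hne hMc

/-! ## §2 Frame rigidity -/

/-- **FRAME RIGIDITY: a non-zero mod-3 Kolyvagin class at ONE Hoffstein–Luo frame of an A1 curve gives one at EVERY
Hoffstein–Luo frame of the curve** (through `BSD(E,3)`: §1, then `Koly.kolyvaginClass_one_ne_zero_of_bsdp_of_hlFrame`).
The route's seam G-b («certificate frame vs Manin-good frame») dissolves in the tree: the ∀-frame typing of the
deciding crux costs nothing over a single frame. PUBLISHED inputs as binders, at both fields (Gross–Zagier,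
Kolyvagin ×2, Skinner 2016 Thm. C, GZK, modularity, Shimura reciprocity at conductor 1, Gross 1991 §3 ×2, McCallum
Cor. 5.6 in both halves). CONDITIONAL on every binder; nothing is booked. [cite: WZhang2014, Remark 5 and Thm. 10.2]
[cite: McCallumLMS1991, §5 Lemma 5.1 and Cor. 5.6] -/
theorem kolyvaginClass_one_ne_zero_allHLFrames_of_one
    (W : WeierstrassCurve ℚ) [W.IsElliptic] [W.IsGloballyMinimal] [NeZero (W.conductorNorm ℤ)]
    -- published inputs (named facts of the tree), quantified over the fields
    (hGZ : ∀ (K : Type) [Field K] [NumberField K], gross_zagier (W.conductorNorm ℤ) W K)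
    (hKo : ∀ (K : Type) [Field K] [NumberField K], kolyvagin (W.conductorNorm ℤ) W K)
    (hB : ∀ (K : Type) [Field K] [NumberField K], Kolyvagin1990_padicValNat_card_sha_le (W.conductorNorm ℤ) W K)
    (hSk : Skinner2016.thmC_padicValRat_bsd_rank_zero)
    (hGZK : rank_eq_analyticRank_of_analyticRank_le_one) (hmod : hasEntireLFunction_rat)
    (hrec : ∀ (K : Type) [Field K] [NumberField K], heegnerPointOfConductor_one_galoisConj (W.conductorNorm ℤ) W K)
    (h1 : ∀ (K : Type) [Field K] [NumberField K],
      phi_heegnerPointOfConductor_mem_range_map_ringClassField (W.conductorNorm ℤ) W K)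
    (h2 : ∀ (K : Type) [Field K] [NumberField K], exists_generator_ringClassGalOver K)
    (hMc : McCallum1991_pow_dvd_card_sha_primary_of_certificate)
    (hMcU : McCallum1991_padicValNat_card_sha_primary_add_le_of_globalDivisibility)
    -- the pair (A1)
    (hX : ClassX11b W 3) (hram : Ram W 3) (htam : ¬ 3 ∣ W.tamagawaProduct)
    -- ONE HL frame with a non-zero class
    (K₀ : Type) [Field K₀] [NumberField K₀]
    (Dt₀ : ModularParametrizationData W (W.conductorNorm ℤ)) (β₀ : ℤ) (ι₀ : K₀ →+* ℂ)
    (hK₀ : IsImaginaryQuadratic K₀) (hodd₀ : Odd (NumberField.discr K₀))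
    (hH₀ : SatisfiesHeegnerHypothesis (W.conductorNorm ℤ) K₀)
    (hLt₀ : (W.quadraticTwist (NumberField.discr K₀ : ℚ)).entireLFunction 1 ≠ 0)
    (hβ₀ : (4 * (W.conductorNorm ℤ : ℤ)) ∣ β₀ ^ 2 - NumberField.discr K₀) (hc₀ : ¬ (3 : ℤ) ∣ Dt₀.c)
    {n₀ : ℕ} (d₀ : KolyvaginHeegnerData Dt₀ β₀ ι₀ n₀)
    (hn₀ : KolyvaginDescent.KolSupp (Zhang2014.IsKolyvaginPrime (W.conductorNorm ℤ) W K₀ 3) n₀)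
    (hne₀ : d₀.kolyvaginClass Nat.prime_three 1 ≠ 0)
    -- ANY HL frame
    (K : Type) [Field K] [NumberField K]
    (Dt : ModularParametrizationData W (W.conductorNorm ℤ)) (β : ℤ) (ι : K →+* ℂ)
    (hK : IsImaginaryQuadratic K) (hodd : Odd (NumberField.discr K))
    (hH : SatisfiesHeegnerHypothesis (W.conductorNorm ℤ) K)
    (hLt : (W.quadraticTwist (NumberField.discr K : ℚ)).entireLFunction 1 ≠ 0)
    (hβ : (4 * (W.conductorNorm ℤ : ℤ)) ∣ β ^ 2 - NumberField.discr K) (hc : ¬ (3 : ℤ) ∣ Dt.c) :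
    ∃ (n : ℕ) (d : KolyvaginHeegnerData Dt β ι n),
      KolyvaginDescent.KolSupp (Zhang2014.IsKolyvaginPrime (W.conductorNorm ℤ) W K 3) n ∧
        d.kolyvaginClass Nat.prime_three 1 ≠ 0 :=
  kolyvaginClass_one_ne_zero_of_bsdp_of_hlFrame W K Dt β ι (hGZ K) (hKo K) hSk hGZK hmod (hrec K) (h1 K) (h2 K)
    hMcU hX hram htam hK hodd hH hLt hβ hc
    (bsdp_three_of_kolyvaginClass_one_ne_zero_at_hlFrame W K₀ Dt₀ β₀ ι₀ (hGZ K₀) (hKo K₀) (hB K₀) hSk hGZK hmod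
      (hrec K₀) (h1 K₀) (h2 K₀) hMc hX hram htam hK₀ hodd₀ hH₀ hLt₀ hβ₀ hc₀ d₀ hn₀ hne₀)

end Summit.BirchSwinnertonDyer.Rank1Residual.X11b.Three.Koly

/-! ## §3 The route item in its weakest form: ∀-frame ⟺ ∃-frame -/

namespace Summit.BirchSwinnertonDyer.BirchSwinnertonDyer.Theorems

open WeierstrassCurve NumberField Literature.NumberTheory.EllipticCurves
  Literature.NumberTheory.EllipticCurves.ModularForms
  Literature.NumberTheory.EllipticCurves.Rank1Residual
  Summit.BirchSwinnertonDyer.Rank1Residual Summit.BirchSwinnertonDyer.Rank1Residual.X11b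
  Summit.BirchSwinnertonDyer.BirchSwinnertonDyer.Theses.KolyvaginRoadThree

/-- **`ZhangSharpFrameAtThreeHL` is EQUIVALENT to its weakest ∃-frame form, modulo the published inputs**: the
∀-frame deciding crux (a non-zero mod-3 class at EVERY Manin-good conductor-1 frame of EVERY Hoffstein–Luo field of
every A1 curve of class X11b) holds iff EVERY such curve has SOME Hoffstein–Luo field, SOME Manin-good frame and SOME
level `n ∈ Λ₃` with `c₁(n) ≠ 0`. Directions: ∀ ⟹ ∃ exhibits a frame by Hoffstein–Luo + Mazur + Darmon 3.6
(`exists_oddHeegnerData`, with `hnf hHL hMaz`); ∃ ⟹ ∀ is frame rigidity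
(`Koly.kolyvaginClass_one_ne_zero_allHLFrames_of_one`: one frame ⟹ `BSD(E,3)` ⟹ every frame). So the route may
state its deciding crux in either typing; a single certified frame per curve is the whole content. CONDITIONAL on
every binder (the published inputs, incl. McCallum Cor. 5.6 in both halves and Gross §3 ×2); nothing is booked.
[cite: WZhang2014, Thm. 1.1, Remark 5 and Thm. 10.2] [cite: McCallumLMS1991, §5 Cor. 5.6]
[cite: HoffsteinLuo1997, main theorem] [cite: Mazur1978, Cor. 4.1] -/
theorem zhangSharpFrameAtThreeHL_iff_exists_kolyvaginClass_one_ne_zero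
    (hGZ : ∀ (N : ℕ) [NeZero N] (W : WeierstrassCurve ℚ) (K : Type) [Field K] [NumberField K],
      gross_zagier N W K)
    (hKo : ∀ (N : ℕ) [NeZero N] (W : WeierstrassCurve ℚ) (K : Type) [Field K] [NumberField K],
      kolyvagin N W K)
    (hB : ∀ (N : ℕ) [NeZero N] (W : WeierstrassCurve ℚ) (K : Type) [Field K] [NumberField K],
      Kolyvagin1990_padicValNat_card_sha_le N W K)
    (hSk : Skinner2016.thmC_padicValRat_bsd_rank_zero)
    (hGZK : rank_eq_analyticRank_of_analyticRank_le_one) (hmod : hasEntireLFunction_rat)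
    (hnf : exists_isNewformOf) (hHL : HoffsteinLuo1997_exists_twist_L_one_ne_zero)
    (hMaz : mazur_not_dvd_maninConstant_of_odd)
    (hrec : ∀ (N : ℕ) [NeZero N] (W : WeierstrassCurve ℚ) (K : Type) [Field K] [NumberField K],
      heegnerPointOfConductor_one_galoisConj N W K)
    (hMc : McCallum1991_pow_dvd_card_sha_primary_of_certificate)
    (hMcU : McCallum1991_padicValNat_card_sha_primary_add_le_of_globalDivisibility)
    (h1 : ∀ (N : ℕ) [NeZero N] (W : WeierstrassCurve ℚ) (K : Type) [Field K] [NumberField K],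
      phi_heegnerPointOfConductor_mem_range_map_ringClassField N W K)
    (h2 : ∀ (K : Type) [Field K] [NumberField K], exists_generator_ringClassGalOver K) :
    ZhangSharpFrameAtThreeHL ↔
      ∀ (W : WeierstrassCurve ℚ) [W.IsElliptic] [W.IsGloballyMinimal] [NeZero (W.conductorNorm ℤ)],
        ClassX11b W 3 → Ram W 3 → ¬ 3 ∣ W.tamagawaProduct →
        ∃ (K : Type) (_ : Field K) (_ : NumberField K)
          (Dt : ModularParametrizationData W (W.conductorNorm ℤ)) (β : ℤ) (ι : K →+* ℂ)
          (n : ℕ) (d : KolyvaginHeegnerData Dt β ι n),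
          IsImaginaryQuadratic K ∧ Odd (NumberField.discr K) ∧
            SatisfiesHeegnerHypothesis (W.conductorNorm ℤ) K ∧
            (W.quadraticTwist (NumberField.discr K : ℚ)).entireLFunction 1 ≠ 0 ∧ ¬ (3 : ℤ) ∣ Dt.c ∧
            KolyvaginDescent.KolSupp (Zhang2014.IsKolyvaginPrime (W.conductorNorm ℤ) W K 3) n ∧
            d.kolyvaginClass Nat.prime_three 1 ≠ 0 := by
  haveI : Fact (Nat.Prime 3) := ⟨Nat.prime_three⟩
  constructor
  · -- ∀ ⟹ ∃: Hoffstein–Luo + Mazur give a frame; the crux gives the class there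
    intro hZ W _ _ _ hX hram htam
    have hmult : W.HasMultiplicativeReductionAtPrime 3 := hX.2.2.1
    have hirr : Irr W 3 := hX.2.2.2
    have hρ : Surj W 3 := surj_of_irr_of_ram W 3 hirr hram
    obtain ⟨K, _, _, Dt, H, ι, P, Wd, _, _, Cd, hK, hodd, h3d, hH, hP, hc, hμ, hLt, hWd⟩ :=
      exists_oddHeegnerData hnf hHL hMaz integral_neronScaling_of_isGloballyMinimal_holds W 3 hX.1
        (by decide) hmult hirr
    have h3 : NumberField.discr K ≠ -3 := by
      intro h
      exact h3d (h ▸ ⟨-1, by norm_num⟩)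
    obtain ⟨n, d, hn, hne⟩ := hZ W K Dt H.β ι hX hmult hρ hram htam hK hodd hH hLt h3 H.dvd_sq_sub hc
    exact ⟨K, inferInstance, inferInstance, Dt, H.β, ι, n, d, hK, hodd, hH, hLt, hc, hn, hne⟩
  · -- ∃ ⟹ ∀: frame rigidity
    intro h W _ _ _ K _ _ Dt β ι hX _hmult _hsurj hram htam hK hodd hH hLt _h3 hβ hc
    obtain ⟨K₀, _, _, Dt₀, β₀, ι₀, n₀, d₀, hK₀, hodd₀, hH₀, hLt₀, hc₀, hn₀, hne₀⟩ := h W hX hram htam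
    exact Summit.BirchSwinnertonDyer.Rank1Residual.X11b.Three.Koly.kolyvaginClass_one_ne_zero_allHLFrames_of_one W
      (fun K _ _ ↦ hGZ _ W K) (fun K _ _ ↦ hKo _ W K) (fun K _ _ ↦ hB _ W K) hSk hGZK hmod (fun K _ _ ↦ hrec _ W K)
      (fun K _ _ ↦ h1 _ W K) h2 hMc hMcU hX hram htam K₀ Dt₀ β₀ ι₀ hK₀ hodd₀ hH₀ hLt₀ d₀.dvd_sq_sub hc₀ d₀ hn₀ hne₀
      K Dt β ι hK hodd hH hLt hβ hc

end Summit.BirchSwinnertonDyer.BirchSwinnertonDyer.Theorems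

end
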